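import Literature.Computability.AlgebraicComplexity.LaserMethodBigCW
import HarnessLib

/-!
# Crux `PerfectAmortisation` (E), line `registered` — stub A `stub_cwRectRestriction`
(tensor layer of the first-power `CW_q` laser method in the far-rectangular weighting)

Support file for crux item stmt-MatrixMultiplication-10893
(`Summit.MatrixMultiplication.MatrixMultiplication.Theses.EPRFaces.PerfectAmortisation`, shared
verbatim with route ShapeSubmodularity), skeleton `Cruxes/PerfectAmortisation/Lines/birth.lean`.

For a free diagonal `Δ` of level triples of `CW_q^{⊗N}` supported coordinatewise in
`{i + j + l = 2}`, all of joint type `(m₁ on (1,1,0), m₂ on (0,1,1), m₃ on (1,0,1))`, the power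
`CW_q^{⊗N}` restricts to `⟨|Δ|⟩ ⊗ ⟨q^{m₁}, q^{m₂}, q^{m₃}⟩`.  This is BCS 1997 Prop. 15.30 with the
proof of Thm. 15.41 (p. 381), i.e. the tree's
`tensorRestrictsTo_kroneckerPow_matMulDirectSum_of_free` instantiated with the level-1 component
data of `CW_q` (`bigCwTensor_component`, `cwLevel₃_mem_support`, `cwFmtK/M/N`, `cwEI/J/L` of
`LaserMethodBigCW.lean`), followed by two bookkeeping steps: the block formats are
`∏_ρ cwFmtK q (s_ρ) = q^{#(1,1,0)}` etc. (`prod_apply_eq_prod_pow_letterCount`), and a direct sum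
of `p` matrix tensors of one common format is (a relabelling of) `⟨p⟩ ⊗ ⟨K', M', N'⟩`.
-/

set_option linter.dupNamespace false
-- (single-conjunct summit: the namespace repeats `MatrixMultiplication`)

namespace Summit.MatrixMultiplication.MatrixMultiplication.Theorems.PerfectAmortisation

open scoped BigOperators
open Finset
open Literature.Computability.AlgebraicComplexity
open Literature.Barriers.MatrixMultiplication (bigCwTensor)

/-- **Equal-format direct sums are multiples.**  If all `p` blocks of `⊕ᵢ ⟨kᵢ, mᵢ, nᵢ⟩` have the
format `⟨K', M', N'⟩`, the direct sum restricts to `⟨p⟩ ⊗ ⟨K', M', N'⟩` (the two tensors differ by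
the relabelling `Fin.cast` of the in-block indices; Bläser 2013, proof of Lemma 7.7:
"`⟨g⟩ ⊗ ⟨k,m,n⟩ = g ⊙ ⟨k,m,n⟩`"). -/
theorem tensorRestrictsTo_matMulDirectSum_multiple_of_eq {p : ℕ} (k m n : Fin p → ℕ)
    {K' M' N' : ℕ} (hk : ∀ i, k i = K') (hm : ∀ i, m i = M') (hn : ∀ i, n i = N') :
    TensorRestrictsTo (matMulDirectSum ℂ k m n)
      (kroneckerTensor (unitTensor ℂ p) (matMulTensor ℂ K' M' N')) := by
  classical
  have key : kroneckerTensor (unitTensor ℂ p) (matMulTensor ℂ K' M' N') = fun a b c =>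
      matMulDirectSum ℂ k m n
        ⟨a.1, (Fin.cast (hk a.1).symm a.2.1, Fin.cast (hn a.1).symm a.2.2)⟩
        ⟨b.1, (Fin.cast (hk b.1).symm b.2.1, Fin.cast (hm b.1).symm b.2.2)⟩
        ⟨c.1, (Fin.cast (hm c.1).symm c.2.1, Fin.cast (hn c.1).symm c.2.2)⟩ := by
    funext a b c
    simp only [kroneckerTensor_unitTensor_apply, matMulTensor, matMulDirectSum, Fin.val_cast,
      Fin.ext_iff, ite_and]
  rw [key]
  exact tensorRestrictsTo_precomp _ _ _ _

/-- The block formats along a label word: `∏_ρ cwFmtK q (s_ρ) = q ^ #{ρ | s_ρ = (1,1,0)}`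
(`cwFmtK q s = q` exactly at `s = (1,1,0)`, else `1`). -/
theorem prod_cwFmtK_eq (q : ℕ) {N : ℕ} (w : Fin N → Fin 3 × Fin 3 × Fin 3) :
    ∏ ρ, cwFmtK q (w ρ) = q ^ letterCount w (1, 1, 0) := by
  classical
  rw [prod_apply_eq_prod_pow_letterCount (cwFmtK q) w,
    Finset.prod_eq_single ((1 : Fin 3), (1 : Fin 3), (0 : Fin 3))]
  · simp [cwFmtK]
  · intro s _ hs
    simp [cwFmtK, hs]
  · simp

/-- `∏_ρ cwFmtM q (s_ρ) = q ^ #{ρ | s_ρ = (0,1,1)}`. -/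
theorem prod_cwFmtM_eq (q : ℕ) {N : ℕ} (w : Fin N → Fin 3 × Fin 3 × Fin 3) :
    ∏ ρ, cwFmtM q (w ρ) = q ^ letterCount w (0, 1, 1) := by
  classical
  rw [prod_apply_eq_prod_pow_letterCount (cwFmtM q) w,
    Finset.prod_eq_single ((0 : Fin 3), (1 : Fin 3), (1 : Fin 3))]
  · simp [cwFmtM]
  · intro s _ hs
    simp [cwFmtM, hs]
  · simp

/-- `∏_ρ cwFmtN q (s_ρ) = q ^ #{ρ | s_ρ = (1,0,1)}`. -/
theorem prod_cwFmtN_eq (q : ℕ) {N : ℕ} (w : Fin N → Fin 3 × Fin 3 × Fin 3) :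
    ∏ ρ, cwFmtN q (w ρ) = q ^ letterCount w (1, 0, 1) := by
  classical
  rw [prod_apply_eq_prod_pow_letterCount (cwFmtN q) w,
    Finset.prod_eq_single ((1 : Fin 3), (0 : Fin 3), (1 : Fin 3))]
  · simp [cwFmtN]
  · intro s _ hs
    simp [cwFmtN, hs]
  · simp

/-- The index maps of the components of `CW_q` stay inside their level blocks (the `hlev` step
of `bigCw_laser_inequality`, BCS p. 383). -/
theorem cwLevel₃_indexMaps (q : ℕ) :
    ∀ s ∈ cwSupport₃,
      (∀ u : Fin (cwFmtK q s) × Fin (cwFmtN q s), cwLevel₃ (cwEI q s u) = s.1) ∧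
      (∀ v : Fin (cwFmtK q s) × Fin (cwFmtM q s), cwLevel₃ (cwEJ q s v) = s.2.1) ∧
      (∀ w : Fin (cwFmtM q s) × Fin (cwFmtN q s), cwLevel₃ (cwEL q s w) = s.2.2) := by
  intro s hs
  rw [mem_cwSupport₃_iff] at hs
  refine ⟨fun u => cwLevel₃_cwIdxOfLevel _ _ ?_, fun v => cwLevel₃_cwIdxOfLevel _ _ ?_,
    fun w => cwLevel₃_cwIdxOfLevel _ _ ?_⟩
  · have h1 := u.1.isLt; have h2 := u.2.isLt
    rcases hs with rfl | rfl | rfl | rfl | rfl | rfl <;>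
      simp [cwFmtK, cwFmtN] at h1 h2 ⊢
  · have h1 := v.1.isLt; have h2 := v.2.isLt
    rcases hs with rfl | rfl | rfl | rfl | rfl | rfl <;>
      simp [cwFmtK, cwFmtM] at h1 h2 ⊢
  · have h1 := w.1.isLt; have h2 := w.2.isLt
    rcases hs with rfl | rfl | rfl | rfl | rfl | rfl <;>
      simp [cwFmtM, cwFmtN] at h1 h2 ⊢

/-- **Stub A (tensor layer: the blocks of one joint type along a free diagonal are a multiple of
one rectangular matrix tensor).**  For level triples `Δ` of `CW_q^{⊗N}` supported coordinatewise in
`{i+j+l = 2}`, all with `m₁` positions of pattern `(1,1,0)`, `m₂` of `(0,1,1)`, `m₃` of `(1,0,1)`,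
forming a free diagonal, `CW_q^{⊗N}` restricts to `⟨|Δ|⟩ ⊗ ⟨q^{m₁}, q^{m₂}, q^{m₃}⟩`
(BCS 1997 Prop. 15.30 / proof of Thm. 15.41 p. 381, via
`tensorRestrictsTo_kroneckerPow_matMulDirectSum_of_free` and the `CW_q` component data
`cwFmtK/M/N`, `cwEI/EJ/EL`, `bigCwTensor_component`). -/
theorem stub_cwRectRestriction :
    ∀ (q m₁ m₂ m₃ N : ℕ)
      (Δ : Finset ((Fin N → Fin 3) × (Fin N → Fin 3) × (Fin N → Fin 3))),
      (∀ δ ∈ Δ, ∀ ρ, labelSeq δ ρ ∈ cwSupport₃) →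
      (∀ δ ∈ Δ, letterCount (labelSeq δ) (1, 1, 0) = m₁ ∧ letterCount (labelSeq δ) (0, 1, 1) = m₂ ∧
        letterCount (labelSeq δ) (1, 0, 1) = m₃) →
      (∀ δ ∈ Δ, ∀ δ' ∈ Δ, ∀ δ'' ∈ Δ, (∀ ρ, (δ.1 ρ, δ'.2.1 ρ, δ''.2.2 ρ) ∈ cwSupport₃) →
        δ = δ' ∧ δ' = δ'') →
      TensorRestrictsTo (kroneckerPow (bigCwTensor ℂ q) N)
        (kroneckerTensor (unitTensor ℂ Δ.card) (matMulTensor ℂ (q ^ m₁) (q ^ m₂) (q ^ m₃))) := by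
  intro q m₁ m₂ m₃ N Δ hS hcnt hfree
  classical
  -- enumerate `Δ` injectively
  set p := Δ.card with hp
  set d : Fin p → (Fin N → Fin 3) × (Fin N → Fin 3) × (Fin N → Fin 3) :=
    fun i => (Δ.equivFin.symm i).1 with hd_def
  have hdmem : ∀ i, d i ∈ Δ := fun i => (Δ.equivFin.symm i).2
  have hd : Function.Injective d := fun i i' h =>
    Δ.equivFin.symm.injective (Subtype.ext h)
  -- BCS Prop. 15.30 for `CW_q` with its level-1 component data
  have hlev := cwLevel₃_indexMaps q
  have hres := tensorRestrictsTo_kroneckerPow_matMulDirectSum_of_free (bigCwTensor ℂ q)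
    cwLevel₃ cwLevel₃ cwLevel₃ cwSupport₃ (fun _ _ _ h => cwLevel₃_mem_support ℂ h)
    (cwFmtK q) (cwFmtM q) (cwFmtN q) (cwEI q) (cwEJ q) (cwEL q)
    (fun s hs u => (hlev s hs).1 u) (fun s hs v => (hlev s hs).2.1 v)
    (fun s hs w => (hlev s hs).2.2 w)
    (fun s hs u v w => bigCwTensor_component ℂ q s hs u v w)
    d (fun i ρ => hS _ (hdmem i) ρ)
    (fun i i' i'' h => by
      have h' := hfree _ (hdmem i) _ (hdmem i') _ (hdmem i'') h
      exact ⟨hd h'.1, hd h'.2⟩)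
  -- the block formats are `⟨q^{m₁}, q^{m₂}, q^{m₃}⟩` for every member of `Δ`
  have hK : ∀ i, ∏ ρ, cwFmtK q (labelSeq (d i) ρ) = q ^ m₁ := fun i => by
    rw [prod_cwFmtK_eq q (labelSeq (d i)), (hcnt _ (hdmem i)).1]
  have hM : ∀ i, ∏ ρ, cwFmtM q (labelSeq (d i) ρ) = q ^ m₂ := fun i => by
    rw [prod_cwFmtM_eq q (labelSeq (d i)), (hcnt _ (hdmem i)).2.1]
  have hN : ∀ i, ∏ ρ, cwFmtN q (labelSeq (d i) ρ) = q ^ m₃ := fun i => by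
    rw [prod_cwFmtN_eq q (labelSeq (d i)), (hcnt _ (hdmem i)).2.2]
  exact hres.trans (tensorRestrictsTo_matMulDirectSum_multiple_of_eq _ _ _ hK hM hN)

end Summit.MatrixMultiplication.MatrixMultiplication.Theorems.PerfectAmortisation
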